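import Mathlib.Data.Matrix.Composition
import Mathlib.LinearAlgebra.Matrix.Reindex
import Mathlib.LinearAlgebra.Matrix.Trace
import Mathlib.Topology.Algebra.OpenSubgroup
import Literature.NumberTheory.GaloisRepresentations.GaloisRep
import Literature.NumberTheory.GaloisRepresentations.ArtinRestriction
import Literature.NumberTheory.GaloisRepresentations.AbsGaloisOuterConj
import HarnessLib

/-!
# Induction of framed Galois representations along a finite extension (trunk GalRep)

Topic `Literature/NumberTheory/GaloisRepresentations`, notion `FramedGaloisRep.induce` (definition
request `defn-FramedGaloisRep.induce` of route `Langlands/SelfDefeatingInduction`: the object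
`R = Ind_{Γ_F}^{Γ_K} ρ` fed to Qian's potential-automorphy theorem).

For a finite extension `F/K` of fields of characteristic `0` (number fields, `p`-adic fields) of
degree `d`, the tree's restriction map `res = absGaloisRestrict K F : Γ_F →ₜ* Γ_K` (`AbsGaloisGroup`;
a closed embedding with open image of index `d`) and a framed Galois representation
`ρ : Γ_F →ₜ* GL_n(A)` (`FramedGaloisRep F A n`), we construct the **induced representation**
`Ind_{Γ_F}^{Γ_K} ρ : Γ_K →ₜ* GL_{d n}(A)` (`FramedGaloisRep.induce`) in its classical **matrix
form** (Serre, *Linear representations of finite groups*, §3.3, proof of Thm. 12; valid verbatim for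
a closed subgroup of finite index of a compact group, §4.3 Remark (g)): choose representatives
`r₁, …, r_d` of the left cosets `Γ_K / res(Γ_F)`; then
`Ind(ρ)(g) = (ρ̇(rᵢ⁻¹ g rⱼ))_{i,j}` as a `d × d` block matrix, where `ρ̇` is `ρ ∘ res⁻¹` on
`res(Γ_F)` and `0` off it.  This is the matrix of `Ind(ρ)(g)` on `V = ⊕ᵢ rᵢ W`
(Serre §3.3: "`ρ_u` sends `ρ_r W` into `ρ_{r_u} W`", with `u r = r_u t`, `t = r_u⁻¹ u r ∈ H`, and
acts there through `θ_t`).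

## Main definitions

* `Literature.NumberTheory.GaloisRepresentations.dotExtend φ π` — extension by zero `π̇ : G → R`
  of `π : H → R` along an injective homomorphism `φ : H →* G` (Curtis–Reiner's `U̇`).
* `Literature.NumberTheory.GaloisRepresentations.indMatrix φ π r g` — the block matrix
  `(π̇(rᵢ⁻¹ g rⱼ))_{i j} : Matrix ι ι R` for a transversal `r : ι → G` of `G / φ(H)`, and the
  monoid homomorphism `indMatrixHom : G →* Matrix ι ι R` (`indMatrix_one`, `indMatrix_mul`).
* `Literature.NumberTheory.GaloisRepresentations.FramedRep.induce φ hφ r hr e ρ` — for topological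
  groups, an open embedding `φ : H →* G` of finite index, a transversal `r` and a relabelling
  `e : ι × Fin n ≃ Fin m`, the induced **framed continuous** representation
  `G →ₜ* GL (Fin m) A` of `ρ : H →ₜ* GL (Fin n) A` (continuity: `π̇` is continuous because
  `φ(H)` is clopen, `continuous_dotExtend`).
* `Literature.NumberTheory.GaloisRepresentations.absGaloisCosetEquiv K F hd`,
  `absGaloisCosetRep K F hd` — for `Module.finrank K F = d`, a labelling
  `Γ_K ⧸ res(Γ_F) ≃ Fin d` of the cosets and a system of representatives.
* `Literature.NumberTheory.GaloisRepresentations.FramedGaloisRep.induce K hd ρ :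
  FramedGaloisRep K A (d * n)` — **`Ind_{Γ_F}^{Γ_K} ρ`** (block `i` occupies the indices
  `n i, …, n i + n - 1`, Mathlib `finProdFinEquiv`).  With `hd : Module.finrank K F = 2` the
  induced representation of a quadratic extension is typed `Γ_K →ₜ* GL (Fin (2 * n)) A`.

## Main results (all proved)

* `indMatrix_one`, `indMatrix_mul` — the block formula is a homomorphism (Serre §3.3 Thm. 12,
  proof; the computation `ρ̇(rᵢ⁻¹ g g' r_k) = ρ̇(rᵢ⁻¹ g rⱼ) ρ̇(rⱼ⁻¹ g' r_k)` for the unique `j`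
  with `rⱼ⁻¹ g' r_k ∈ H`).
* `continuous_dotExtend`, `continuous_indMatrix`, `FramedRep.continuous_indFlatHom` — continuity
  for an open embedding.
* `trace_indMatrix`, `FramedRep.trace_induce`, `FramedGaloisRep.trace_induce` — **the character
  of the induced representation**: `tr Ind(ρ)(g) = ∑ᵢ (tr ρ)̇(rᵢ⁻¹ g rᵢ)` (sum over the cosets
  `i` with `rᵢ⁻¹ g rᵢ ∈ res(Γ_F)`; Serre §3.3 Thm. 12 / §7.2 Prop. 20).
* `indMatrix_apply_map_of_normal`, `FramedGaloisRep.induce_absGaloisRestrict_coe`,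
  `FramedGaloisRep.induce_restrictField_apply_coe` — **restriction to the subgroup**: for `φ(H)`
  normal (e.g. `F/K` Galois), `Ind(ρ)(res σ)` is block diagonal with blocks the conjugates
  `ρ^{rᵢ⁻¹}(σ)` (`FramedGaloisRep.outerConj`, `AbsGaloisOuterConj`); this is
  `Res Ind ρ = ⊕ᵢ ρ^{rᵢ⁻¹}` (Serre §7.3 Prop. 22 with `K = H` normal; for `[F : K] = 2`,
  `Ind(ρ)|_{Γ_F} ≅ ρ ⊕ ρ^σ`).
* `FramedRep.induce_baseChange`, `FramedGaloisRep.induce_baseChange` — induction commutes with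
  base change along a continuous ring homomorphism (coefficient extension, reduction modulo `𝔪`).
* `indMatrix_comp_submatrix`, `indMatrix_mul_map_apply`, `indMatrix_units_conj`,
  `FramedRep.induce_conj` — **dependence on the choices**: relabelling the cosets relabels the
  blocks, moving the representatives inside their cosets conjugates by a block diagonal matrix,
  and a change of frame `ρ ↦ P ρ P⁻¹` conjugates `Ind(ρ)` by `diag(P, …, P)`
  (`FramedRep.blockScalar`); so `Ind` is well defined up to conjugation (Serre §3.3 Thm. 11).
* `isOpen_range_absGaloisRestrict`, `nat_card_quotient_range_absGaloisRestrict`,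
  `isOpenEmbedding_absGaloisRestrict` — `res(Γ_F) ≤ Γ_K` is open of index `[F : K]` and `res` is
  an open embedding (char. `0`; from `mem_range_absGaloisRestrict_iff_smul_absEmbedding` and
  Mathlib `IntermediateField.finrank_eq_fixingSubgroup_index`; the index statement is also
  `index_range_absGaloisRestrict_eq_finrank` of `ArtinFormalismInductionProofs` and the index half
  of `Literature.NumberTheory.Automorphic.isOpen_range_absGaloisRestrict_and_index`, re-derived
  here in a few lines to keep this definition file free of the `L`-function / automorphic imports
  of those files).

## Mathlib declarations used rather than redefined

`Function.extend` (extension by zero), `QuotientGroup` (`G ⧸ S`, `QuotientGroup.eq`,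
`QuotientGroup.out_eq'`), `Matrix.comp` / `Matrix.compRingEquiv` (flattening block matrices),
`Matrix.reindexRingEquiv`, `finProdFinEquiv`, `MonoidHom.toHomUnits`, `Units.continuous_iff`,
`Topology.IsOpenEmbedding` (`continuousAt_iff`), `Subgroup.isClosed_of_isOpen`,
`Finite.equivFin`, `IntermediateField.finrank_eq_fixingSubgroup_index`,
`InfiniteGalois.isOpen_iff_finite`.  Mathlib's abstract induced representations
`Representation.ind` / `Representation.coind` (`RepresentationTheory/Induced.lean`,
`Coinduced.lean`, `FiniteIndex.lean`) carry no topology, no basis and no frame; the framed matrix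
form is what the consumers (`FramedGaloisRep`, `IsConjugate`, Frobenius characteristic
polynomials) need, so it is constructed directly and the comparison with `Representation.ind` is
left to a later file.

## Design notes

* Everything is defined along an *injective homomorphism* `φ : H →* G` rather than for a subgroup,
  because the tree's `Γ_F → Γ_K`, `Γ_{F_v} → Γ_{K_w}` and `W_{E'} → W_E` are such maps.
* The transversal `r` and the relabelling `e` are parameters of the general construction; another
  choice changes `Ind` by conjugation by a monomial block matrix, so all statements about
  `FramedGaloisRep.induce` that matter are invariant (`IsConjugate`-level).  The Galois version
  fixes `r` by `Quotient.out` and `e = finProdFinEquiv`.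
* The rank is `d * n` with `d` supplied through `hd : Module.finrank K F = d`, so that
  `ρ.induce K rfl : FramedGaloisRep K A (Module.finrank K F * n)` and, for a quadratic extension,
  `ρ.induce K h2 : FramedGaloisRep K A (2 * n)`.
* Only `[CharZero K] [FiniteDimensional K F]` are assumed (`CharZero F` follows and is derived
  inside proofs; compactness of `Γ_F` is used for the embedding property of `res`).

## References

* J.-P. Serre, *Linear representations of finite groups*, GTM 42 (1977), §3.3 (induced
  representations, Thm. 11, Thm. 12 and its proof: the matrix form), §4.3 Remark (g) (compact
  groups, closed subgroups of finite index), §7.2 Prop. 20 (character), §7.3 Prop. 22 (restriction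
  to subgroups, Mackey), §7.4 Cor. (normal subgroups). [SerreLinearRepresentations1977]
* J. Neukirch, *Algebraic Number Theory* (1999), Ch. IV §1 (Krull topology; open subgroups of
  finite index). [NeukirchANT1999]
* J.-P. Serre, *Abelian ℓ-adic representations and elliptic curves* (1968), Ch. I §2.1
  (restriction to `Γ_L` for an extension `L/K`). [SerreAbelianLadic1968]
-/

noncomputable section

open Topology Matrix Field

namespace Literature.NumberTheory.GaloisRepresentations

universe u v

/-! ### Extension by zero along an injective homomorphism -/

section DotExtend

variable {H G R : Type*} [Group H] [Group G]

/-- **`π̇`, the extension by zero of `π : H → R` along `φ : H →* G`**: `π̇ (φ h) = π h` (for `φ`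
injective) and `π̇ g = 0` for `g ∉ φ(H)` (Mathlib `Function.extend`).  This is the "`U̇`" of the
matrix form of induced representations.
Ref: Serre, *Linear representations of finite groups*, §3.3, proof of Thm. 12. [folklore] -/
def dotExtend [Zero R] (φ : H →* G) (π : H → R) : G → R :=
  Function.extend φ π 0

/-- `π̇ (φ h) = π h` for `φ` injective. [folklore] -/
@[simp] theorem dotExtend_apply_map [Zero R] {φ : H →* G} (hφ : Function.Injective φ)
    (π : H → R) (h : H) : dotExtend φ π (φ h) = π h :=
  hφ.extend_apply _ _ h

/-- `π̇ g = 0` off the image of `φ`. [folklore] -/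
theorem dotExtend_of_not_mem [Zero R] (φ : H →* G) (π : H → R) {g : G} (hg : g ∉ φ.range) :
    dotExtend φ π g = 0 :=
  Function.extend_apply' _ _ _ fun ⟨a, ha⟩ => hg ⟨a, ha⟩

/-- `π̇ ∘ φ = π`. [folklore] -/
theorem dotExtend_comp [Zero R] {φ : H →* G} (hφ : Function.Injective φ) (π : H → R) :
    dotExtend φ π ∘ φ = π :=
  funext fun h => dotExtend_apply_map hφ π h

/-- A map `f` with `f 0 = 0` commutes with extension by zero: `f (π̇ g) = (f ∘ π)̇ g`. [folklore] -/
theorem apply_dotExtend {R' : Type*} [Zero R] [Zero R'] {φ : H →* G} (hφ : Function.Injective φ)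
    (π : H → R) (f : R → R') (hf : f 0 = 0) (g : G) :
    f (dotExtend φ π g) = dotExtend φ (f ∘ π) g := by
  by_cases hg : g ∈ φ.range
  · obtain ⟨h, rfl⟩ := hg
    rw [dotExtend_apply_map hφ, dotExtend_apply_map hφ, Function.comp_apply]
  · rw [dotExtend_of_not_mem φ π hg, dotExtend_of_not_mem φ _ hg, hf]

/-- Entries of a matrix-valued `π̇`: `(π̇ g) a b = (π · a b)̇ g`. [folklore] -/
theorem dotExtend_matrix_apply {p q : Type*} [Zero R] {φ : H →* G} (hφ : Function.Injective φ)
    (π : H → Matrix p q R) (g : G) (a : p) (b : q) :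
    dotExtend φ π g a b = dotExtend φ (fun h => π h a b) g :=
  apply_dotExtend hφ π (fun M : Matrix p q R => M a b) rfl g

/-- `π̇ 1 = 1` for a monoid homomorphism `π`. [folklore] -/
theorem dotExtend_one [MulZeroOneClass R] {φ : H →* G} (hφ : Function.Injective φ) (π : H →* R) :
    dotExtend φ π 1 = 1 := by
  rw [← φ.map_one, dotExtend_apply_map hφ, map_one]

/-- `π̇ (x · φ b) = π̇ x · π b`. [folklore] -/
theorem dotExtend_mul_map [MulZeroOneClass R] {φ : H →* G} (hφ : Function.Injective φ)
    (π : H →* R) (x : G) (b : H) : dotExtend φ π (x * φ b) = dotExtend φ π x * π b := by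
  by_cases hx : x ∈ φ.range
  · obtain ⟨a, rfl⟩ := hx
    rw [← map_mul, dotExtend_apply_map hφ, dotExtend_apply_map hφ, map_mul]
  · rw [dotExtend_of_not_mem φ π hx, zero_mul, dotExtend_of_not_mem φ π]
    intro h
    apply hx
    simpa using φ.range.mul_mem h (φ.range.inv_mem ⟨b, rfl⟩)

/-- `π̇ (φ a · x) = π a · π̇ x`. [folklore] -/
theorem dotExtend_map_mul [MulZeroOneClass R] {φ : H →* G} (hφ : Function.Injective φ)
    (π : H →* R) (a : H) (x : G) : dotExtend φ π (φ a * x) = π a * dotExtend φ π x := by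
  by_cases hx : x ∈ φ.range
  · obtain ⟨b, rfl⟩ := hx
    rw [← map_mul, dotExtend_apply_map hφ, dotExtend_apply_map hφ, map_mul]
  · rw [dotExtend_of_not_mem φ π hx, mul_zero, dotExtend_of_not_mem φ π]
    intro h
    apply hx
    simpa using φ.range.mul_mem (φ.range.inv_mem ⟨a, rfl⟩) h

end DotExtend

/-! ### The block matrix of the induced representation -/

section IndMatrix

variable {H G R : Type*} [Group H] [Group G] {ι : Type*}

/-- Left cosets: `rᵢ⁻¹ g rⱼ ∈ φ(H)` iff `g` maps the coset of `rⱼ` to the coset of `rᵢ`. [folklore] -/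
theorem inv_mul_mul_mem_range_iff (φ : H →* G) (r : ι → G) (g : G) (i j : ι) :
    (r i)⁻¹ * g * r j ∈ φ.range ↔ (r i : G ⧸ φ.range) = (g * r j : G) := by
  rw [QuotientGroup.eq, mul_assoc]

/-- **The matrix form of the induced representation.**  For `φ : H →* G`, `π : H → R` and a
system of representatives `r : ι → G` of the left cosets `G / φ(H)`, the block matrix
`Ind(π)(g) = (π̇ (rᵢ⁻¹ g rⱼ))_{i, j}` (`dotExtend`; block `(i, j)` is nonzero exactly when
`g rⱼ ∈ rᵢ φ(H)`).
Ref: Serre, *Linear representations of finite groups*, §3.3, proof of Thm. 12 ("`ρ_u` sends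
`ρ_r W` into `ρ_{r_u} W`", acting through `θ_t`, `t = r_u⁻¹ u r`). [cite: SerreLinearRepresentations1977, §3.3 Thm. 12 (proof)] -/
def indMatrix [Zero R] (φ : H →* G) (π : H → R) (r : ι → G) (g : G) : Matrix ι ι R :=
  Matrix.of fun i j => dotExtend φ π ((r i)⁻¹ * g * r j)

/-- Unfolding lemma for `indMatrix`. [folklore] -/
@[simp] theorem indMatrix_apply [Zero R] (φ : H →* G) (π : H → R) (r : ι → G) (g : G) (i j : ι) :
    indMatrix φ π r g i j = dotExtend φ π ((r i)⁻¹ * g * r j) := rfl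

/-- A map `f` with `f 0 = 0` applied entrywise to `Ind(π)(g)` gives `Ind(f ∘ π)(g)`. [folklore] -/
theorem indMatrix_map {R' : Type*} [Zero R] [Zero R'] {φ : H →* G} (hφ : Function.Injective φ)
    (π : H → R) (r : ι → G) (f : R → R') (hf : f 0 = 0) (g : G) :
    (indMatrix φ π r g).map f = indMatrix φ (f ∘ π) r g := by
  ext i j
  exact apply_dotExtend hφ π f hf _

/-- **`Ind(π)(1) = 1`** (distinct representatives lie in distinct cosets).
Ref: Serre, *Linear representations of finite groups*, §3.3 Thm. 12. [folklore] -/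
theorem indMatrix_one [MulZeroOneClass R] [DecidableEq ι] {φ : H →* G} (hφ : Function.Injective φ)
    (π : H →* R) {r : ι → G} (hr : Function.Injective fun i => (r i : G ⧸ φ.range)) :
    indMatrix φ π r 1 = 1 := by
  ext i j
  rw [indMatrix_apply, mul_one, Matrix.one_apply]
  split_ifs with hij
  · subst hij
    rw [inv_mul_cancel, dotExtend_one hφ]
  · refine dotExtend_of_not_mem φ π fun hmem => hij (hr ?_)
    change (r i : G ⧸ φ.range) = (r j : G)
    rwa [QuotientGroup.eq]

/-- **`Ind(π)(g g') = Ind(π)(g) Ind(π)(g')`**: for fixed `i, k` only the unique `j` with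
`rⱼ⁻¹ g' r_k ∈ φ(H)` contributes, and `π̇ (rᵢ⁻¹ g rⱼ) π̇ (rⱼ⁻¹ g' r_k) = π̇ (rᵢ⁻¹ g g' r_k)`.
Ref: Serre, *Linear representations of finite groups*, §3.3 Thm. 12 (proof). [cite: SerreLinearRepresentations1977, §3.3 Thm. 12 (proof)] -/
theorem indMatrix_mul [Semiring R] [Fintype ι] {φ : H →* G} (hφ : Function.Injective φ)
    (π : H →* R) {r : ι → G} (hr : Function.Bijective fun i => (r i : G ⧸ φ.range)) (g g' : G) :
    indMatrix φ π r (g * g') = indMatrix φ π r g * indMatrix φ π r g' := by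
  ext i k
  obtain ⟨j₀, hj₀⟩ := hr.2 ((g' * r k : G) : G ⧸ φ.range)
  have hmem : (r j₀)⁻¹ * g' * r k ∈ φ.range := (inv_mul_mul_mem_range_iff φ r g' j₀ k).2 hj₀
  obtain ⟨b, hb⟩ := hmem
  rw [Matrix.mul_apply, Finset.sum_eq_single j₀]
  · rw [indMatrix_apply, indMatrix_apply, indMatrix_apply, ← hb, dotExtend_apply_map hφ,
      ← dotExtend_mul_map hφ, hb]
    congr 1
    group
  · intro j _ hj
    rw [indMatrix_apply, indMatrix_apply]
    have hj' : (r j)⁻¹ * g' * r k ∉ φ.range := fun h =>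
      hj (hr.1 (((inv_mul_mul_mem_range_iff φ r g' j k).1 h).trans hj₀.symm))
    rw [dotExtend_of_not_mem φ π hj', mul_zero]
  · intro h
    exact absurd (Finset.mem_univ j₀) h

/-- **The induced matrix representation as a monoid homomorphism** `G →* Matrix ι ι R`.
Ref: Serre, *Linear representations of finite groups*, §3.3 Thm. 11–12. [cite: SerreLinearRepresentations1977, §3.3 Thm. 12 (proof)] -/
def indMatrixHom [Semiring R] [Fintype ι] [DecidableEq ι] {φ : H →* G}
    (hφ : Function.Injective φ) (π : H →* R) (r : ι → G)
    (hr : Function.Bijective fun i => (r i : G ⧸ φ.range)) : G →* Matrix ι ι R where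
  toFun := indMatrix φ π r
  map_one' := indMatrix_one hφ π hr.1
  map_mul' := indMatrix_mul hφ π hr

/-- Unfolding lemma for `indMatrixHom`. [folklore] -/
@[simp] theorem indMatrixHom_apply [Semiring R] [Fintype ι] [DecidableEq ι] {φ : H →* G}
    (hφ : Function.Injective φ) (π : H →* R) (r : ι → G)
    (hr : Function.Bijective fun i => (r i : G ⧸ φ.range)) (g : G) :
    indMatrixHom hφ π r hr g = indMatrix φ π r g := rfl

/-- **The character of the induced representation** (block level): the trace of `Ind(π)(g)` in
`R` is `∑ᵢ π̇ (rᵢ⁻¹ g rᵢ)`, the sum of the diagonal blocks, i.e. over the cosets fixed by `g`.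
Ref: Serre, *Linear representations of finite groups*, §3.3 Thm. 12; §7.2 Prop. 20. [cite: SerreLinearRepresentations1977, §3.3 Thm. 12] -/
theorem trace_indMatrix [AddCommMonoid R] [Fintype ι] (φ : H →* G) (π : H → R) (r : ι → G)
    (g : G) : Matrix.trace (indMatrix φ π r g) = ∑ i, dotExtend φ π ((r i)⁻¹ * g * r i) := rfl

/-- **Restriction to the subgroup, normal case.**  If `φ(H)` is normal in `G` (e.g. `F/K` Galois),
then `Ind(π)(φ h)` is block *diagonal*, with diagonal blocks `π̇ (rᵢ⁻¹ φ(h) rᵢ)`, the conjugate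
representations `π^{rᵢ⁻¹}` (`Res_H Ind_H^G π = ⊕ᵢ π^{rᵢ⁻¹}`).
Ref: Serre, *Linear representations of finite groups*, §7.3 Prop. 22 (with `K = H`), §7.4 Cor. [cite: SerreLinearRepresentations1977, §7.3 Prop. 22] -/
theorem indMatrix_apply_map_of_normal [Zero R] [DecidableEq ι] (φ : H →* G) (π : H → R)
    {r : ι → G} (hr : Function.Injective fun i => (r i : G ⧸ φ.range)) (hN : φ.range.Normal)
    (h : H) :
    indMatrix φ π r (φ h) = Matrix.diagonal fun i => dotExtend φ π ((r i)⁻¹ * φ h * r i) := by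
  ext i j
  rw [indMatrix_apply, Matrix.diagonal_apply]
  split_ifs with hij
  · subst hij
    rfl
  · refine dotExtend_of_not_mem φ π fun hmem => hij (hr ?_)
    change (r i : G ⧸ φ.range) = (r j : G)
    rw [QuotientGroup.eq]
    have h2 : (r j)⁻¹ * (φ h)⁻¹ * r j ∈ φ.range := by
      simpa using hN.conj_mem _ (φ.range.inv_mem ⟨h, rfl⟩) (r j)⁻¹
    have := φ.range.mul_mem hmem h2
    convert this using 1
    group

/-! #### Dependence on the choices: relabelling, other representatives, change of frame -/

/-- Relabelling the representatives along `σ : ι' → ι` relabels the blocks. [folklore] -/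
theorem indMatrix_comp_submatrix {ι' : Type*} [Zero R] (φ : H →* G) (π : H → R) (r : ι → G)
    (σ : ι' → ι) (g : G) : indMatrix φ π (r ∘ σ) g = (indMatrix φ π r g).submatrix σ σ := rfl

/-- **Changing the representatives inside their cosets**, `rᵢ ↦ rᵢ φ(hᵢ)`, conjugates the block
matrix by the block diagonal matrix `diag(π(hᵢ))`: block `(i, j)` becomes
`π(hᵢ)⁻¹ π̇ (rᵢ⁻¹ g rⱼ) π(hⱼ)` (so `Ind` is well defined up to isomorphism).
Ref: Serre, *Linear representations of finite groups*, §3.3 Thm. 11 (uniqueness). [folklore] -/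
theorem indMatrix_mul_map_apply [MulZeroOneClass R] {φ : H →* G} (hφ : Function.Injective φ)
    (π : H →* R) (r : ι → G) (h : ι → H) (g : G) (i j : ι) :
    indMatrix φ π (fun i => r i * φ (h i)) g i j = π (h i)⁻¹ * indMatrix φ π r g i j * π (h j) := by
  rw [indMatrix_apply, indMatrix_apply]
  have : (r i * φ (h i))⁻¹ * g * (r j * φ (h j)) = φ (h i)⁻¹ * ((r i)⁻¹ * g * r j) * φ (h j) := by
    rw [map_inv]
    group
  rw [this, dotExtend_mul_map hφ, dotExtend_map_mul hφ]

/-- **A change of frame `π ↦ u π u⁻¹` conjugates every block**: `(u π u⁻¹)̇ = u π̇ u⁻¹`. [folklore] -/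
theorem dotExtend_units_conj [MonoidWithZero R] {φ : H →* G} (hφ : Function.Injective φ)
    (π : H → R) (u : Rˣ) (g : G) :
    dotExtend φ (fun h => (u : R) * π h * (u⁻¹ : Rˣ)) g = u * dotExtend φ π g * (u⁻¹ : Rˣ) :=
  (apply_dotExtend hφ π (fun x : R => (u : R) * x * (u⁻¹ : Rˣ)) (by simp) g).symm

/-- A change of frame `π ↦ u π u⁻¹` conjugates `Ind(π)(g)` by the block scalar matrix
`diag(u, …, u)` (Mathlib `Matrix.scalar`). [folklore] -/
theorem indMatrix_units_conj [Semiring R] [Fintype ι] [DecidableEq ι] {φ : H →* G}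
    (hφ : Function.Injective φ) (π : H → R) (r : ι → G) (u : Rˣ) (g : G) :
    indMatrix φ (fun h => (u : R) * π h * (u⁻¹ : Rˣ)) r g =
      Matrix.scalar ι (u : R) * indMatrix φ π r g * Matrix.scalar ι ((u⁻¹ : Rˣ) : R) := by
  ext i j
  rw [indMatrix_apply, dotExtend_units_conj hφ, Matrix.scalar_apply, Matrix.scalar_apply,
    Matrix.mul_diagonal, Matrix.diagonal_mul, indMatrix_apply]

end IndMatrix

/-! ### Continuity for an open embedding of finite index -/

section Continuity

variable {H G R : Type*} [Group H] [TopologicalSpace H] [Group G] [TopologicalSpace G]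
  [IsTopologicalGroup G]

/-- **`π̇` is continuous** for an open embedding `φ : H → G` of topological groups and a continuous
`π`: `φ(H)` is an open, hence closed, subgroup, `π̇` is `0` on its open complement and `π̇ ∘ φ = π`
near every point of `φ(H)`. [folklore] -/
theorem continuous_dotExtend [Zero R] [TopologicalSpace R] {φ : H →* G} (hφ : IsOpenEmbedding φ)
    {π : H → R} (hπ : Continuous π) : Continuous (dotExtend φ π) := by
  refine continuous_iff_continuousAt.2 fun g => ?_
  by_cases hg : g ∈ φ.range
  · obtain ⟨h, rfl⟩ := hg
    rw [← hφ.continuousAt_iff, dotExtend_comp hφ.injective]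
    exact hπ.continuousAt
  · have hopen : IsOpen ((φ.range : Set G)ᶜ) :=
      (Subgroup.isClosed_of_isOpen φ.range hφ.isOpen_range).isOpen_compl
    refine (continuousAt_const (y := (0 : R))).congr ?_
    exact Filter.eventually_of_mem (hopen.mem_nhds hg) fun x hx => (dotExtend_of_not_mem φ π hx).symm

/-- `g ↦ Ind(π)(g)` is continuous (entrywise: `π̇ (rᵢ⁻¹ g rⱼ)`). [folklore] -/
theorem continuous_indMatrix {ι : Type*} [Zero R] [TopologicalSpace R] {φ : H →* G}
    (hφ : IsOpenEmbedding φ) {π : H → R} (hπ : Continuous π) (r : ι → G) :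
    Continuous (indMatrix φ π r) :=
  continuous_matrix fun _ _ =>
    (continuous_dotExtend hφ hπ).comp ((continuous_const.mul continuous_id).mul continuous_const)

end Continuity

/-! ### Induction of framed continuous representations -/

section BlockScalar

variable {A : Type*} [CommRing A] {n m : ℕ} {ι : Type*} [Fintype ι] [DecidableEq ι]

namespace FramedRep

/-- The block scalar embedding `M ↦ diag(M, …, M)` of `n × n` matrices into `m × m` matrices
(flattened and relabelled along `e : ι × Fin n ≃ Fin m`; Mathlib `Matrix.scalar`,
`Matrix.compRingEquiv`, `Matrix.reindexRingEquiv`). [folklore] -/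
def blockScalar (e : ι × Fin n ≃ Fin m) : Matrix (Fin n) (Fin n) A →+* Matrix (Fin m) (Fin m) A :=
  ((Matrix.compRingEquiv ι (Fin n) A).trans (Matrix.reindexRingEquiv A e)).toRingHom.comp
    (Matrix.scalar ι)

/-- Unfolding lemma for `blockScalar`. [folklore] -/
theorem blockScalar_apply (e : ι × Fin n ≃ Fin m) (M : Matrix (Fin n) (Fin n) A) :
    blockScalar e M = Matrix.reindex e e (Matrix.comp ι ι (Fin n) (Fin n) A (Matrix.scalar ι M)) :=
  rfl

end FramedRep

end BlockScalar

section FramedAlgebra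

variable {H : Type*} {G : Type*} [Group H] [TopologicalSpace H] [Group G]
  {A : Type*} [CommRing A] [TopologicalSpace A] {n m : ℕ} {ι : Type*} [Fintype ι] [DecidableEq ι]

namespace FramedRep

/-- The matrix-valued homomorphism `h ↦ (ρ h : Matrix)` underlying a framed representation
(Mathlib `Units.coeHom`). [folklore] -/
abbrev toMatrixHom (ρ : FramedRep H A n) : H →* Matrix (Fin n) (Fin n) A :=
  (Units.coeHom (Matrix (Fin n) (Fin n) A)).comp (ρ : H →* GL (Fin n) A)

/-- Unfolding lemma for `FramedRep.toMatrixHom`. [folklore] -/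
@[simp] theorem toMatrixHom_apply (ρ : FramedRep H A n) (h : H) :
    ρ.toMatrixHom h = ((ρ h : GL (Fin n) A) : Matrix (Fin n) (Fin n) A) := rfl

/-- `h ↦ (ρ h : Matrix)` is continuous. [folklore] -/
theorem continuous_toMatrixHom (ρ : FramedRep H A n) : Continuous ρ.toMatrixHom :=
  Units.continuous_val.comp ρ.continuous

/-- The flattened matrix form `G →* Matrix (Fin m) (Fin m) A` of the induced representation of a
framed representation `ρ`: the blocks `ρ̇ (rᵢ⁻¹ g rⱼ)` (`indMatrixHom`) flattened by
`Matrix.compRingEquiv` and relabelled along `e : ι × Fin n ≃ Fin m`.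
Ref: Serre, *Linear representations of finite groups*, §3.3 Thm. 12 (proof). [folklore] -/
def indFlatHom {φ : H →* G} (hφ : Function.Injective φ) (r : ι → G)
    (hr : Function.Bijective fun i => (r i : G ⧸ φ.range)) (e : ι × Fin n ≃ Fin m)
    (ρ : FramedRep H A n) : G →* Matrix (Fin m) (Fin m) A :=
  ((Matrix.compRingEquiv ι (Fin n) A).trans (Matrix.reindexRingEquiv A e)).toRingHom.toMonoidHom.comp
    (indMatrixHom hφ ρ.toMatrixHom r hr)

/-- Entries of the flattened matrix form: entry `(x, y)` with `e.symm x = (i, a)`,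
`e.symm y = (j, b)` is the `(a, b)` entry of the block `ρ̇ (rᵢ⁻¹ g rⱼ)`. [folklore] -/
@[simp] theorem indFlatHom_apply {φ : H →* G} (hφ : Function.Injective φ) (r : ι → G)
    (hr : Function.Bijective fun i => (r i : G ⧸ φ.range)) (e : ι × Fin n ≃ Fin m)
    (ρ : FramedRep H A n) (g : G) (x y : Fin m) :
    indFlatHom hφ r hr e ρ g x y =
      dotExtend φ ρ.toMatrixHom ((r (e.symm x).1)⁻¹ * g * r (e.symm y).1)
        (e.symm x).2 (e.symm y).2 := rfl

/-- The flattened matrix form is `reindex e e (comp (indMatrix …))`. [folklore] -/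
theorem indFlatHom_apply_eq_reindex {φ : H →* G} (hφ : Function.Injective φ) (r : ι → G)
    (hr : Function.Bijective fun i => (r i : G ⧸ φ.range)) (e : ι × Fin n ≃ Fin m)
    (ρ : FramedRep H A n) (g : G) :
    indFlatHom hφ r hr e ρ g =
      Matrix.reindex e e (Matrix.comp ι ι (Fin n) (Fin n) A (indMatrix φ ρ.toMatrixHom r g)) :=
  rfl

end FramedRep

end FramedAlgebra

section Framed

variable {H : Type*} {G : Type*} [Group H] [TopologicalSpace H] [Group G] [TopologicalSpace G]
  [IsTopologicalGroup G] {A : Type*} [CommRing A] [TopologicalSpace A] {n m : ℕ}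
  {ι : Type*} [Fintype ι] [DecidableEq ι]

namespace FramedRep

/-- The flattened matrix form is continuous when `φ` is an open embedding. [folklore] -/
theorem continuous_indFlatHom {φ : H →* G} (hφ : IsOpenEmbedding φ) (r : ι → G)
    (hr : Function.Bijective fun i => (r i : G ⧸ φ.range)) (e : ι × Fin n ≃ Fin m)
    (ρ : FramedRep H A n) : Continuous (indFlatHom hφ.injective r hr e ρ) :=
  continuous_matrix fun x y =>
    ((continuous_dotExtend hφ ρ.continuous_toMatrixHom).matrix_elem (e.symm x).2 (e.symm y).2).comp
      ((continuous_const.mul continuous_id).mul continuous_const)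

/-- **Induction of a framed continuous representation along an open embedding of finite index.**
For topological groups `H`, `G`, an injective homomorphism `φ : H →* G` which is an open embedding
(so `φ(H)` is an open subgroup; it has finite index as soon as `ι` is finite), a system of
representatives `r : ι → G` of `G / φ(H)`, a relabelling `e : ι × Fin n ≃ Fin m` and a framed
representation `ρ : H →ₜ* GL_n(A)`, the framed representation
`Ind(ρ) : G →ₜ* GL_m(A)`, `g ↦ (ρ̇ (rᵢ⁻¹ g rⱼ))_{i,j}` (matrix form of `Ind_H^G ρ` on `⊕ᵢ rᵢ Aⁿ`).
Continuity: the entries are continuous (`continuous_dotExtend`) and `Ind(ρ)(g)⁻¹ = Ind(ρ)(g⁻¹)`.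
Ref: Serre, *Linear representations of finite groups*, §3.3 (Thm. 11, Thm. 12 and its proof),
§4.3 Remark (g) (closed subgroups of finite index of compact groups). [cite: SerreLinearRepresentations1977, §3.3 Thm. 12 (proof)] -/
def induce (φ : H →* G) (hφ : IsOpenEmbedding φ) (r : ι → G)
    (hr : Function.Bijective fun i => (r i : G ⧸ φ.range)) (e : ι × Fin n ≃ Fin m)
    (ρ : FramedRep H A n) : FramedRep G A m where
  toMonoidHom := (indFlatHom hφ.injective r hr e ρ).toHomUnits
  continuous_toFun := by
    refine Units.continuous_iff.2 ⟨?_, ?_⟩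
    · exact continuous_indFlatHom hφ r hr e ρ
    · exact (continuous_indFlatHom hφ r hr e ρ).comp continuous_inv

/-- The matrix of `Ind(ρ)(g)` is the flattened block matrix `(ρ̇ (rᵢ⁻¹ g rⱼ))_{i,j}`. [folklore] -/
@[simp] theorem induce_apply_coe (φ : H →* G) (hφ : IsOpenEmbedding φ) (r : ι → G)
    (hr : Function.Bijective fun i => (r i : G ⧸ φ.range)) (e : ι × Fin n ≃ Fin m)
    (ρ : FramedRep H A n) (g : G) :
    ((induce φ hφ r hr e ρ g : GL (Fin m) A) : Matrix (Fin m) (Fin m) A) =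
      indFlatHom hφ.injective r hr e ρ g := rfl

/-- Entries of `Ind(ρ)(g)`. [folklore] -/
theorem induce_apply_coe_apply (φ : H →* G) (hφ : IsOpenEmbedding φ) (r : ι → G)
    (hr : Function.Bijective fun i => (r i : G ⧸ φ.range)) (e : ι × Fin n ≃ Fin m)
    (ρ : FramedRep H A n) (g : G) (x y : Fin m) :
    ((induce φ hφ r hr e ρ g : GL (Fin m) A) : Matrix (Fin m) (Fin m) A) x y =
      dotExtend φ ρ.toMatrixHom ((r (e.symm x).1)⁻¹ * g * r (e.symm y).1)
        (e.symm x).2 (e.symm y).2 := rfl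

omit [DecidableEq ι] in
/-- The trace of a relabelled flattened block matrix is the sum of the traces of the diagonal
blocks. [folklore] -/
theorem trace_reindex_comp {R : Type*} [AddCommMonoid R] (e : ι × Fin n ≃ Fin m)
    (M : Matrix ι ι (Matrix (Fin n) (Fin n) R)) :
    Matrix.trace (Matrix.reindex e e (Matrix.comp ι ι (Fin n) (Fin n) R M)) =
      ∑ i, Matrix.trace (M i i) := by
  unfold Matrix.trace Matrix.diag
  rw [← e.sum_comp, Fintype.sum_prod_type]
  simp

/-- **Character of the induced representation**: `tr Ind(ρ)(g) = ∑ᵢ (tr ρ)̇ (rᵢ⁻¹ g rᵢ)`, the sum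
over the cosets `i` with `rᵢ⁻¹ g rᵢ ∈ φ(H)` of `tr ρ (φ⁻¹ (rᵢ⁻¹ g rᵢ))`.
Ref: Serre, *Linear representations of finite groups*, §3.3 Thm. 12; §7.2 Prop. 20. [cite: SerreLinearRepresentations1977, §3.3 Thm. 12] -/
theorem trace_induce (φ : H →* G) (hφ : IsOpenEmbedding φ) (r : ι → G)
    (hr : Function.Bijective fun i => (r i : G ⧸ φ.range)) (e : ι × Fin n ≃ Fin m)
    (ρ : FramedRep H A n) (g : G) :
    (induce φ hφ r hr e ρ).trace g = ∑ i, dotExtend φ ρ.trace ((r i)⁻¹ * g * r i) := by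
  change Matrix.trace (indFlatHom hφ.injective r hr e ρ g) = _
  rw [indFlatHom_apply_eq_reindex, trace_reindex_comp]
  refine Finset.sum_congr rfl fun i _ => ?_
  rw [indMatrix_apply]
  exact apply_dotExtend hφ.injective _ Matrix.trace (Matrix.trace_zero _ _) _

/-- **`Ind` of a change of frame is a change of frame**: `Ind(P ρ P⁻¹) = D Ind(ρ) D⁻¹` with
`D = diag(P, …, P)` (`blockScalar`), so `Ind` is well defined on conjugacy (isomorphism) classes of
framed representations.
Ref: Serre, *Linear representations of finite groups*, §3.3 Thm. 11 (uniqueness of the induced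
representation). [folklore] -/
theorem induce_conj [IsTopologicalRing A] (φ : H →* G) (hφ : IsOpenEmbedding φ) (r : ι → G)
    (hr : Function.Bijective fun i => (r i : G ⧸ φ.range)) (e : ι × Fin n ≃ Fin m)
    (P : GL (Fin n) A) (ρ : FramedRep H A n) :
    induce φ hφ r hr e (ρ.conj P) =
      (induce φ hφ r hr e ρ).conj (Units.map (blockScalar (ι := ι) e).toMonoidHom P) := by
  refine ContinuousMonoidHom.ext fun g => Units.ext ?_
  rw [conj_apply, Units.val_mul, Units.val_mul, induce_apply_coe, induce_apply_coe, ← map_inv,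
    Units.coe_map, Units.coe_map, indFlatHom_apply_eq_reindex, indFlatHom_apply_eq_reindex]
  change _ = blockScalar e (P : Matrix (Fin n) (Fin n) A) *
    ((Matrix.compRingEquiv ι (Fin n) A).trans (Matrix.reindexRingEquiv A e))
      (indMatrix φ ρ.toMatrixHom r g) * blockScalar e ((P⁻¹ : GL (Fin n) A) : Matrix (Fin n) (Fin n) A)
  rw [blockScalar, RingHom.comp_apply, RingHom.comp_apply, RingEquiv.toRingHom_eq_coe,
    RingHom.coe_coe, ← map_mul, ← map_mul, ← indMatrix_units_conj hφ.injective]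
  rfl

/-- **Induction commutes with base change** along a continuous ring homomorphism `f : A → B`
(coefficient extension, reduction modulo an ideal): `Ind(ρ ⊗_A B) = Ind(ρ) ⊗_A B` entrywise.
[folklore] -/
theorem induce_baseChange {B : Type*} [CommRing B] [TopologicalSpace B] (f : A →+* B)
    (hf : Continuous f) (φ : H →* G) (hφ : IsOpenEmbedding φ) (r : ι → G)
    (hr : Function.Bijective fun i => (r i : G ⧸ φ.range)) (e : ι × Fin n ≃ Fin m)
    (ρ : FramedRep H A n) :
    induce φ hφ r hr e (ρ.baseChange f hf) = (induce φ hφ r hr e ρ).baseChange f hf := by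
  refine ContinuousMonoidHom.ext fun g => Units.ext ?_
  ext x y
  rw [induce_apply_coe_apply, dotExtend_matrix_apply hφ.injective, baseChange_apply]
  change _ = f (((induce φ hφ r hr e ρ g : GL (Fin m) A) : Matrix (Fin m) (Fin m) A) x y)
  rw [induce_apply_coe_apply, dotExtend_matrix_apply hφ.injective,
    apply_dotExtend hφ.injective _ f (map_zero f)]
  rfl

end FramedRep

end Framed

/-! ### `res(Γ_F) ≤ Γ_K`: open of index `[F : K]`, and `res` is an open embedding -/

section GaloisIndex

variable (K F : Type*) [Field K] [Field F] [Algebra K F]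

/-- **`res(Γ_F) = Gal(K̄/e(F))`**: the image of `Γ_F → Γ_K` is the fixing subgroup of the copy
`e(F) ⊆ K̄` of `F` (`absEmbedding`, `mem_range_absGaloisRestrict_iff_smul_absEmbedding`).
Ref: Neukirch, *Algebraic Number Theory*, Ch. IV §1; Milne, *Fields and Galois Theory*, §7. [folklore] -/
theorem range_absGaloisRestrict_eq_fixingSubgroup_absEmbedding [Algebra.IsAlgebraic K F] :
    (absGaloisRestrict K F).range =
      ((absEmbedding K F).fieldRange.fixingSubgroup : Subgroup (absoluteGaloisGroup K)) := by
  ext g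
  refine (mem_range_absGaloisRestrict_iff_smul_absEmbedding K F g).trans
    (Iff.trans ?_ (mem_fixingSubgroup_iff_forall_smul (absEmbedding K F).fieldRange g).symm)
  constructor
  · rintro h ⟨x, ⟨k, rfl⟩⟩
    exact h k
  · intro h k
    exact h ⟨absEmbedding K F k, ⟨k, rfl⟩⟩

variable [CharZero K] [FiniteDimensional K F]

/-- **`[Γ_K : res(Γ_F)] = [F : K]`** (as `Nat.card` of the coset space) for a finite extension
`F/K` of fields of characteristic `0` (Krull: `[K̄^H : K] = [Γ_K : H]`, Mathlib
`IntermediateField.finrank_eq_fixingSubgroup_index`).  Same content as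
`index_range_absGaloisRestrict_eq_finrank` (`ArtinFormalismInductionProofs`) and the index half of
`Literature.NumberTheory.Automorphic.isOpen_range_absGaloisRestrict_and_index`, re-derived to keep
this file's imports inside the topic.
Ref: Neukirch, *Algebraic Number Theory*, Ch. IV §1. [folklore] -/
theorem nat_card_quotient_range_absGaloisRestrict :
    Nat.card (absoluteGaloisGroup K ⧸ (absGaloisRestrict K F).range) = Module.finrank K F := by
  haveI : FiniteDimensional K (absEmbedding K F).fieldRange :=
    LinearEquiv.finiteDimensional (absEmbedding K F).equivFieldRange.toLinearEquiv
  change (absGaloisRestrict K F).range.index = _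
  rw [range_absGaloisRestrict_eq_fixingSubgroup_absEmbedding,
    (absEmbedding K F).equivFieldRange.toLinearEquiv.finrank_eq]
  exact (IntermediateField.finrank_eq_fixingSubgroup_index (absEmbedding K F).fieldRange).symm

/-- `res(Γ_F)` is open in `Γ_K` (`F/K` finite, characteristic `0`).
Ref: Neukirch, *Algebraic Number Theory*, Ch. IV §1. [folklore] -/
theorem isOpen_range_absGaloisRestrict : IsOpen (Set.range (absGaloisRestrict K F)) := by
  haveI : FiniteDimensional K (absEmbedding K F).fieldRange :=
    LinearEquiv.finiteDimensional (absEmbedding K F).equivFieldRange.toLinearEquiv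
  change IsOpen ((absGaloisRestrict K F).range : Set (absoluteGaloisGroup K))
  rw [range_absGaloisRestrict_eq_fixingSubgroup_absEmbedding]
  exact (InfiniteGalois.isOpen_iff_finite (absEmbedding K F).fieldRange).mpr inferInstance

/-- **`res : Γ_F → Γ_K` is an open embedding** for `F/K` finite of characteristic `0` (a closed
embedding, `isClosedEmbedding_absGaloisRestrict`, with open image). [folklore] -/
theorem isOpenEmbedding_absGaloisRestrict : IsOpenEmbedding (absGaloisRestrict K F) := by
  haveI : CharZero F := charZero_of_injective_algebraMap (algebraMap K F).injective
  exact ⟨(isClosedEmbedding_absGaloisRestrict K F).isEmbedding, isOpen_range_absGaloisRestrict K F⟩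

/-- The coset space `Γ_K / res(Γ_F)` is finite. [folklore] -/
instance finite_quotient_range_absGaloisRestrict :
    Finite (absoluteGaloisGroup K ⧸ (absGaloisRestrict K F).range) :=
  Nat.finite_of_card_ne_zero <| by
    rw [nat_card_quotient_range_absGaloisRestrict]
    exact Module.finrank_pos.ne'

variable {d : ℕ}

/-- **A labelling `Γ_K / res(Γ_F) ≃ Fin d` of the cosets** when `[F : K] = d` (a choice). [folklore] -/
def absGaloisCosetEquiv (hd : Module.finrank K F = d) :
    absoluteGaloisGroup K ⧸ (absGaloisRestrict K F).range ≃ Fin d :=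
  (Finite.equivFin _).trans (finCongr ((nat_card_quotient_range_absGaloisRestrict K F).trans hd))

/-- **A system of representatives `r₁, …, r_d ∈ Γ_K` of `Γ_K / res(Γ_F)`** (a choice,
`Quotient.out` of the labelling `absGaloisCosetEquiv`).
Ref: Serre, *Linear representations of finite groups*, §3.3 ("system of representatives"). [folklore] -/
def absGaloisCosetRep (hd : Module.finrank K F = d) (i : Fin d) : absoluteGaloisGroup K :=
  ((absGaloisCosetEquiv K F hd).symm i).out

/-- `rᵢ` represents the coset labelled `i`. [folklore] -/
@[simp] theorem mk_absGaloisCosetRep (hd : Module.finrank K F = d) (i : Fin d) :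
    (absGaloisCosetRep K F hd i : absoluteGaloisGroup K ⧸ (absGaloisRestrict K F).range) =
      (absGaloisCosetEquiv K F hd).symm i :=
  QuotientGroup.out_eq' _

/-- The representatives `rᵢ` form a transversal of `Γ_K / res(Γ_F)`. [folklore] -/
theorem absGaloisCosetRep_bijective (hd : Module.finrank K F = d) :
    Function.Bijective fun i =>
      (absGaloisCosetRep K F hd i : absoluteGaloisGroup K ⧸ (absGaloisRestrict K F).range) := by
  have : (fun i => (absGaloisCosetRep K F hd i :
      absoluteGaloisGroup K ⧸ (absGaloisRestrict K F).range)) = (absGaloisCosetEquiv K F hd).symm :=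
    funext (mk_absGaloisCosetRep K F hd)
  rw [this]
  exact (absGaloisCosetEquiv K F hd).symm.bijective

end GaloisIndex

/-! ### The induced Galois representation `Ind_{Γ_F}^{Γ_K} ρ` -/

section Galois

variable (K : Type u) {F : Type v} [Field K] [Field F] [Algebra K F] [CharZero K]
  [FiniteDimensional K F] {A : Type*} [CommRing A] [TopologicalSpace A] {n d : ℕ}

namespace FramedGaloisRep

/-- **The induced Galois representation `Ind_{Γ_F}^{Γ_K} ρ : Γ_K →ₜ* GL_{d n}(A)`** of a framed
Galois representation `ρ : Γ_F →ₜ* GL_n(A)` along a finite extension `F/K` of degree `d`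
(`hd : Module.finrank K F = d`; fields of characteristic `0`), in matrix form: with the chosen
representatives `r₁, …, r_d` of `Γ_K / res(Γ_F)` (`absGaloisCosetRep`),
`Ind(ρ)(g) = (ρ̇ (rᵢ⁻¹ g rⱼ))_{i,j}`, `ρ̇ = ρ ∘ res⁻¹` on `res(Γ_F)` and `0` off it; block `(i, j)`
sits at rows `n i + a`, columns `n j + b` (`finProdFinEquiv`).  It is continuous, of rank
`d n = [F : K] · n`, and well defined up to conjugation (other choices of `res`, of the
representatives and of the labelling conjugate it by a monomial block matrix).  For a quadratic
extension, `ρ.induce K h2 : FramedGaloisRep K A (2 * n)`.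
Ref: Serre, *Linear representations of finite groups*, §3.3 (Thm. 11–12), §4.3 Remark (g); Serre,
*Abelian ℓ-adic representations* (1968), Ch. I §2.1. [cite: SerreLinearRepresentations1977, §3.3 Thm. 12 (proof)] -/
def induce (hd : Module.finrank K F = d) (ρ : FramedGaloisRep F A n) : FramedGaloisRep K A (d * n) :=
  FramedRep.induce (absGaloisRestrict K F).toMonoidHom (isOpenEmbedding_absGaloisRestrict K F)
    (absGaloisCosetRep K F hd) (absGaloisCosetRep_bijective K F hd) finProdFinEquiv ρ

/-- Unfolding lemma: `FramedGaloisRep.induce` is `FramedRep.induce` along `res` with the chosen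
transversal and the relabelling `finProdFinEquiv`. [folklore] -/
theorem induce_def (hd : Module.finrank K F = d) (ρ : FramedGaloisRep F A n) :
    ρ.induce K hd =
      FramedRep.induce (absGaloisRestrict K F).toMonoidHom (isOpenEmbedding_absGaloisRestrict K F)
        (absGaloisCosetRep K F hd) (absGaloisCosetRep_bijective K F hd) finProdFinEquiv ρ :=
  rfl

/-- **Entries of `Ind(ρ)(g)`**: the entry in row `n i + a`, column `n j + b` is the `(a, b)` entry
of the block `ρ̇ (rᵢ⁻¹ g rⱼ)`. [folklore] -/
theorem induce_apply_coe_apply (hd : Module.finrank K F = d) (ρ : FramedGaloisRep F A n)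
    (g : absoluteGaloisGroup K) (x y : Fin (d * n)) :
    ((ρ.induce K hd g : GL (Fin (d * n)) A) : Matrix (Fin (d * n)) (Fin (d * n)) A) x y =
      dotExtend (absGaloisRestrict K F).toMonoidHom (FramedRep.toMatrixHom ρ)
        ((absGaloisCosetRep K F hd (finProdFinEquiv.symm x).1)⁻¹ * g *
          absGaloisCosetRep K F hd (finProdFinEquiv.symm y).1)
        (finProdFinEquiv.symm x).2 (finProdFinEquiv.symm y).2 :=
  rfl

/-- **The blocks on `res(Γ_F)`-translates**: `ρ̇ (res σ) = ρ σ`. [folklore] -/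
theorem dotExtend_absGaloisRestrict (ρ : FramedGaloisRep F A n) (σ : absoluteGaloisGroup F) :
    dotExtend (absGaloisRestrict K F).toMonoidHom (FramedRep.toMatrixHom ρ) (absGaloisRestrict K F σ) =
      ((ρ σ : GL (Fin n) A) : Matrix (Fin n) (Fin n) A) :=
  dotExtend_apply_map (absGaloisRestrict_injective K F) _ σ

/-- **Character formula for `Ind_{Γ_F}^{Γ_K} ρ`** (Frobenius): `tr Ind(ρ)(g) = ∑ᵢ (tr ρ)̇ (rᵢ⁻¹ g rᵢ)`,
i.e. the sum, over the cosets `i` with `rᵢ⁻¹ g rᵢ = res σᵢ ∈ res(Γ_F)`, of `tr ρ(σᵢ)`.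
Ref: Serre, *Linear representations of finite groups*, §3.3 Thm. 12; §7.2 Prop. 20. [cite: SerreLinearRepresentations1977, §3.3 Thm. 12] -/
theorem trace_induce (hd : Module.finrank K F = d) (ρ : FramedGaloisRep F A n)
    (g : absoluteGaloisGroup K) :
    FramedRep.trace (ρ.induce K hd) g =
      ∑ i : Fin d, dotExtend (absGaloisRestrict K F).toMonoidHom (FramedRep.trace ρ)
        ((absGaloisCosetRep K F hd i)⁻¹ * g * absGaloisCosetRep K F hd i) :=
  FramedRep.trace_induce _ _ _ _ _ ρ g

/-- **Induction commutes with base change** (coefficient extension / reduction):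
`Ind(ρ ⊗ B) = Ind(ρ) ⊗ B`. [folklore] -/
theorem induce_baseChange {B : Type*} [CommRing B] [TopologicalSpace B] (f : A →+* B)
    (hf : Continuous f) (hd : Module.finrank K F = d) (ρ : FramedGaloisRep F A n) :
    induce K hd (FramedRep.baseChange f hf ρ) = FramedRep.baseChange f hf (ρ.induce K hd) :=
  FramedRep.induce_baseChange f hf _ _ _ _ _ ρ

variable [IsGalois K F] [CharZero F]

/-- **The diagonal blocks of `Ind(ρ)(res σ)` are the conjugates `ρ^{rᵢ⁻¹}(σ)`**
(`FramedGaloisRep.outerConj`): `ρ̇ (rᵢ⁻¹ res(σ) rᵢ) = ρ (θ_{rᵢ⁻¹} σ)`. [folklore] -/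
theorem dotExtend_conj_absGaloisRestrict (ρ : FramedGaloisRep F A n) (τ : absoluteGaloisGroup K)
    (σ : absoluteGaloisGroup F) :
    dotExtend (absGaloisRestrict K F).toMonoidHom (FramedRep.toMatrixHom ρ)
        (τ⁻¹ * absGaloisRestrict K F σ * τ) =
      ((ρ.outerConj τ⁻¹ σ : GL (Fin n) A) : Matrix (Fin n) (Fin n) A) := by
  rw [FramedGaloisRep.outerConj_apply, ← dotExtend_absGaloisRestrict K,
    absGaloisRestrict_absGaloisOuterConj, inv_inv]

/-- **Restriction of `Ind_{Γ_F}^{Γ_K} ρ` to `Γ_F` for `F/K` Galois**: `Ind(ρ)(res σ)` is the block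
diagonal matrix `diag(ρ^{r₁⁻¹}(σ), …, ρ^{r_d⁻¹}(σ))` of the conjugate representations
(`Res Ind ρ ≅ ⊕_{s ∈ Gal(F/K)} ρ^s`; for `[F : K] = 2`: `Ind(ρ)|_{Γ_F} ≅ ρ ⊕ ρ^σ` up to the frame).
Ref: Serre, *Linear representations of finite groups*, §7.3 Prop. 22, §7.4 Cor. [cite: SerreLinearRepresentations1977, §7.3 Prop. 22] -/
theorem induce_absGaloisRestrict_coe (hd : Module.finrank K F = d) (ρ : FramedGaloisRep F A n)
    (σ : absoluteGaloisGroup F) :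
    ((ρ.induce K hd (absGaloisRestrict K F σ) : GL (Fin (d * n)) A) :
        Matrix (Fin (d * n)) (Fin (d * n)) A) =
      Matrix.reindex finProdFinEquiv finProdFinEquiv
        (Matrix.comp (Fin d) (Fin d) (Fin n) (Fin n) A
          (Matrix.diagonal fun i =>
            ((ρ.outerConj (absGaloisCosetRep K F hd i)⁻¹ σ : GL (Fin n) A) :
              Matrix (Fin n) (Fin n) A))) := by
  rw [induce_def, FramedRep.induce_apply_coe, FramedRep.indFlatHom_apply_eq_reindex]
  congr 2
  rw [show absGaloisRestrict K F σ = (absGaloisRestrict K F).toMonoidHom σ from rfl,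
    indMatrix_apply_map_of_normal _ _ (absGaloisCosetRep_bijective K F hd).1
      (normal_range_absGaloisRestrict K F)]
  congr 1
  funext i
  exact dotExtend_conj_absGaloisRestrict K ρ _ σ

/-- The restriction `(Ind ρ)|_{Γ_F}` (`restrictField`) evaluated at `σ`, block-diagonal form.
[folklore] -/
theorem induce_restrictField_apply_coe (hd : Module.finrank K F = d) (ρ : FramedGaloisRep F A n)
    (σ : absoluteGaloisGroup F) :
    (((ρ.induce K hd).restrictField F σ : GL (Fin (d * n)) A) :
        Matrix (Fin (d * n)) (Fin (d * n)) A) =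
      Matrix.reindex finProdFinEquiv finProdFinEquiv
        (Matrix.comp (Fin d) (Fin d) (Fin n) (Fin n) A
          (Matrix.diagonal fun i =>
            ((ρ.outerConj (absGaloisCosetRep K F hd i)⁻¹ σ : GL (Fin n) A) :
              Matrix (Fin n) (Fin n) A))) := by
  rw [restrictField_apply]
  exact induce_absGaloisRestrict_coe K hd ρ σ

end FramedGaloisRep

end Galois

end Literature.NumberTheory.GaloisRepresentations
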